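import Literature.Analysis.FluidPDE.LocalBiotSavartCalculus
import Literature.Analysis.UnboundedOperators.HeatKernelBoundedData
import Literature.Analysis.UnboundedOperators.HeatIteratedDerivBounds
import Mathlib.MeasureTheory.Integral.IntervalIntegral.FundThmCalculus
import HarnessLib

/-!
# Lei–Zhang 2011, Theorem 1.4 — the heat-flow gauge, III: the Duhamel corrector
# `w − e^{Δ}w = curl ∫₀¹ e^{σΔ} curl w dσ`

Analysis/FluidPDE **proofs file** (theorems only: no definitions, no named facts, no `sorry`)
on the discharge path of `Literature.Analysis.FluidPDE.LeiZhang2011_regularity_bmoStream`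
(Z. Lei, Q. S. Zhang, J. Funct. Anal. 261 (2011) = arXiv:1011.5066, **Theorem 1.4**; see
`LeiZhang2011HeatGauge` for the rôle of the gauge). For a divergence-free field
`w ∈ C²(ℝ³; ℝ³)` with `w`, `Dw`, `D²w` bounded, the **Duhamel corrector**
`A(y) = ∫₀¹ e^{σΔ}(curl w)(y) dσ` is a bounded differentiable field with

  `curl A = w − e^{Δ}w`

(`curl_duhamelCorrector`): derivatives fall on the bounded data (`D e^{σΔ}ω = e^{σΔ} Dω`,
`HeatIteratedDerivBounds`), so `curl A = ∫₀¹ e^{σΔ}(curl curl w) dσ = −∫₀¹ e^{σΔ}(Δw) dσ`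
(`Δw = −curl curl w`, `laplacian_eq_neg_curl_curl`), and `e^{σΔ}(Δw) = ∂_σ e^{σΔ}w`
(`hasDerivAt_heatExtension_time_of_bounded`) integrates to `e^{Δ}w − w` (`e^{σΔ}w → w` as
`σ → 0⁺`, `tendsto_heatExtension_nhdsGT_zero_of_continuousAt`). Together with the smoothed stream
`e^{Δ}B` of `LeiZhang2011HeatGaugeStream` (`curl e^{Δ}B = e^{Δ}w`) this gives the differentiable
`BMO` stream function `e^{Δ}B + A` of `w`.

## References

* Z. Lei, Q. S. Zhang, J. Funct. Anal. 261 (2011) = arXiv:1011.5066, Thm. 1.4 and §4.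
  [LeiZhang2011]
* L. C. Evans, *Partial Differential Equations*, 2nd ed. (2010), §2.3.1 Thm. 1. [Evans2010]
-/

noncomputable section

open MeasureTheory Set Function Filter Topology Metric intervalIntegral
open scoped InnerProductSpace RealInnerProductSpace NNReal ENNReal Laplacian

namespace Literature.Analysis.FluidPDE

open Literature.Analysis.UnboundedOperators

/-! ### The time integral of caloric extensions of bounded `C¹` data -/

section TimeIntegral

variable {F : Type*} [NormedAddCommGroup F] [NormedSpace ℝ F]

/-- `σ ↦ e^{σΔ} g (y)` is a.e.-strongly measurable on `(0, 1)` for bounded continuous `g`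
(it is continuous on `(0, ∞)`). [folklore] -/
theorem aestronglyMeasurable_heatExtension_time {g : EuclideanSpace ℝ (Fin 3) → F}
    (hg : Continuous g) {C : ℝ} (hC : ∀ z, ‖g z‖ ≤ C) (y : EuclideanSpace ℝ (Fin 3)) :
    AEStronglyMeasurable (fun σ : ℝ => heatExtension g σ y) (volume.restrict (Ioo 0 1)) :=
  ((continuousOn_heatExtension_time (memLp_top_of_continuous_of_bound hg hC) le_top y).mono
    Ioo_subset_Ioi_self).aestronglyMeasurable measurableSet_Ioo

/-- `σ ↦ e^{σΔ} g (y)` is integrable on `(0, 1)` for bounded continuous `g`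
(`‖e^{σΔ}g‖ ≤ sup ‖g‖`). [folklore] -/
theorem integrableOn_heatExtension_time {g : EuclideanSpace ℝ (Fin 3) → F}
    (hg : Continuous g) {C : ℝ} (hC : ∀ z, ‖g z‖ ≤ C) (y : EuclideanSpace ℝ (Fin 3)) :
    IntegrableOn (fun σ : ℝ => heatExtension g σ y) (Ioo 0 1) volume := by
  have hconst : IntegrableOn (fun _ : ℝ => C) (Ioo (0 : ℝ) 1) volume :=
    integrableOn_const measure_Ioo_lt_top.ne
  refine Integrable.mono' hconst (aestronglyMeasurable_heatExtension_time hg hC y) ?_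
  exact (ae_restrict_iff' measurableSet_Ioo).2 (Eventually.of_forall fun σ hσ =>
    norm_heatExtension_le hC hσ.1 y)

/-- **Differentiating the time integral of caloric extensions under the integral sign**: for
`g ∈ C¹(ℝ³; F)` with `g`, `Dg` bounded, `A(y) = ∫₀¹ e^{σΔ} g (y) dσ` has the Fréchet derivative
`∫₀¹ e^{σΔ}(Dg)(y) dσ` (`D e^{σΔ} g = e^{σΔ} Dg`, dominated by `sup ‖Dg‖`). [folklore] -/
theorem hasFDerivAt_integral_heatExtension_time [CompleteSpace F] {g : EuclideanSpace ℝ (Fin 3) → F}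
    (hg : ContDiff ℝ 1 g) {C₀ C₁ : ℝ} (h0 : ∀ z, ‖g z‖ ≤ C₀) (h1 : ∀ z, ‖fderiv ℝ g z‖ ≤ C₁)
    (y₀ : EuclideanSpace ℝ (Fin 3)) :
    HasFDerivAt (fun y : EuclideanSpace ℝ (Fin 3) => ∫ σ in Ioo (0 : ℝ) 1, heatExtension g σ y)
      (∫ σ in Ioo (0 : ℝ) 1, heatExtension (fderiv ℝ g) σ y₀) y₀ := by
  have hgc : Continuous g := hg.continuous
  have hDc : Continuous (fderiv ℝ g) := hg.continuous_fderiv one_ne_zero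
  refine hasFDerivAt_integral_of_dominated_of_fderiv_le (μ := volume.restrict (Ioo (0 : ℝ) 1))
    (F := fun (y : EuclideanSpace ℝ (Fin 3)) (σ : ℝ) => heatExtension g σ y)
    (F' := fun (y : EuclideanSpace ℝ (Fin 3)) (σ : ℝ) => heatExtension (fderiv ℝ g) σ y)
    (x₀ := y₀) (bound := fun _ => C₁) (ball_mem_nhds y₀ zero_lt_one)
    (Eventually.of_forall fun y => aestronglyMeasurable_heatExtension_time hgc h0 y)
    (integrableOn_heatExtension_time hgc h0 y₀)
    (aestronglyMeasurable_heatExtension_time hDc h1 y₀) ?_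
    (integrableOn_const measure_Ioo_lt_top.ne) ?_
  · exact (ae_restrict_iff' measurableSet_Ioo).2 (Eventually.of_forall fun σ hσ y _ =>
      norm_heatExtension_le h1 hσ.1 y)
  · refine (ae_restrict_iff' measurableSet_Ioo).2 (Eventually.of_forall fun σ hσ y _ => ?_)
    have hd : DifferentiableAt ℝ (heatExtension g σ) y :=
      (contDiff_heatExtension_of_bound hgc h0 hσ.1 (m := 1)).differentiable (by simp) y
    have h := hd.hasFDerivAt
    rwa [fderiv_heatExtension_of_bounded hg h0 h1 hσ.1 y] at h

/-- The time integral of caloric extensions of bounded data is bounded by the same constant: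
`‖∫₀¹ e^{σΔ} g (y) dσ‖ ≤ sup ‖g‖`. [folklore] -/
theorem norm_integral_heatExtension_time_le {g : EuclideanSpace ℝ (Fin 3) → F}
    {C : ℝ} (hC : ∀ z, ‖g z‖ ≤ C) (y : EuclideanSpace ℝ (Fin 3)) :
    ‖∫ σ in Ioo (0 : ℝ) 1, heatExtension g σ y‖ ≤ C := by
  have h := norm_setIntegral_le_of_norm_le_const (f := fun σ : ℝ => heatExtension g σ y)
    (s := Ioo (0 : ℝ) 1) (μ := volume) (C := C) measure_Ioo_lt_top
    (fun σ hσ => norm_heatExtension_le hC hσ.1 y)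
  simpa using h

end TimeIntegral

/-! ### The curl of caloric extensions and of the Duhamel corrector -/

/-- **The curl falls on bounded `C¹` data**: `curl (e^{σΔ}ω) = e^{σΔ}(curl ω)` for `ω ∈ C¹`
with `ω`, `Dω` bounded (`curl = curlCLM ∘ D` and `D e^{σΔ}ω = e^{σΔ} Dω`). [folklore] -/
theorem curl_heatExtension_of_bounded
    {ω : EuclideanSpace ℝ (Fin 3) → EuclideanSpace ℝ (Fin 3)} (hω : ContDiff ℝ 1 ω)
    {C₀ C₁ : ℝ} (h0 : ∀ z, ‖ω z‖ ≤ C₀) (h1 : ∀ z, ‖fderiv ℝ ω z‖ ≤ C₁) {σ : ℝ} (hσ : 0 < σ)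
    (y : EuclideanSpace ℝ (Fin 3)) :
    curl (heatExtension ω σ) y = heatExtension (curl ω) σ y := by
  rw [curl_eq_curlCLM, fderiv_heatExtension_of_bounded hω h0 h1 hσ y,
    ← heatExtension_clm_comp_of_bound curlCLM (hω.continuous_fderiv one_ne_zero) h1 hσ y]
  rfl

/-- Bounds for the vorticity of a field with bounded first and second derivatives:
`curl w ∈ C¹`, `‖curl w‖ ≤ ‖curlCLM‖ sup ‖Dw‖`, `‖D curl w‖ ≤ ‖curlCLM‖ sup ‖D²w‖`. [folklore] -/
theorem curl_bounds_of_bounded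
    {w : EuclideanSpace ℝ (Fin 3) → EuclideanSpace ℝ (Fin 3)} (hw : ContDiff ℝ 2 w)
    {C₁ C₂ : ℝ} (h1 : ∀ z, ‖fderiv ℝ w z‖ ≤ C₁) (h2 : ∀ z, ‖fderiv ℝ (fderiv ℝ w) z‖ ≤ C₂) :
    ContDiff ℝ 1 (curl w) ∧ (∀ z, ‖curl w z‖ ≤ ‖curlCLM‖ * C₁) ∧
      ∀ z, ‖fderiv ℝ (curl w) z‖ ≤ ‖curlCLM‖ * C₂ := by
  have hD : ContDiff ℝ 1 (fderiv ℝ w) := hw.fderiv_right (m := 1) le_rfl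
  have hc : ContDiff ℝ 1 (curl w) := by
    rw [curl_eq_curlCLM_comp]
    exact curlCLM.contDiff.comp hD
  refine ⟨hc, fun z => ?_, fun z => ?_⟩
  · rw [curl_eq_curlCLM]
    exact (curlCLM.le_opNorm _).trans (mul_le_mul_of_nonneg_left (h1 z) (norm_nonneg _))
  · have hd : DifferentiableAt ℝ (fderiv ℝ w) z := hD.differentiable (by simp) z
    have h := (curlCLM.hasFDerivAt.comp z hd.hasFDerivAt).fderiv
    rw [curl_eq_curlCLM_comp, h]
    exact (ContinuousLinearMap.opNorm_comp_le _ _).trans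
      (mul_le_mul_of_nonneg_left (h2 z) (norm_nonneg _))

/-- **The Duhamel corrector.** Let `w ∈ C²(ℝ³; ℝ³)` be divergence free with `w`, `Dw`, `D²w`
bounded. Then `A(y) = ∫₀¹ e^{σΔ}(curl w)(y) dσ` is differentiable, bounded by
`‖curlCLM‖ sup ‖Dw‖`, and **`curl A = w − e^{Δ}w`**: `curl A = ∫₀¹ e^{σΔ}(curl curl w) dσ
= −∫₀¹ e^{σΔ}(Δw) dσ = −∫₀¹ ∂_σ (e^{σΔ}w) dσ = w − e^{Δ}w` (`Δw = −curl curl w` for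
divergence-free `w`; the heat equation with the Laplacian on the data; `e^{σΔ}w → w` as
`σ → 0⁺`). Evans, *PDE*, §2.3.1 Thm. 1; Majda–Bertozzi Prop. 2.16. [folklore] -/
theorem curl_duhamelCorrector
    {w : EuclideanSpace ℝ (Fin 3) → EuclideanSpace ℝ (Fin 3)} (hw : ContDiff ℝ 2 w)
    (hdiv : VectorCalculus.IsDivFree w) {C₀ C₁ C₂ : ℝ} (h0 : ∀ z, ‖w z‖ ≤ C₀)
    (h1 : ∀ z, ‖fderiv ℝ w z‖ ≤ C₁) (h2 : ∀ z, ‖fderiv ℝ (fderiv ℝ w) z‖ ≤ C₂) :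
    Differentiable ℝ (fun y : EuclideanSpace ℝ (Fin 3) =>
        ∫ σ in Ioo (0 : ℝ) 1, heatExtension (curl w) σ y) ∧
      (∀ y, ‖∫ σ in Ioo (0 : ℝ) 1, heatExtension (curl w) σ y‖ ≤ ‖curlCLM‖ * C₁) ∧
      ∀ y, curl (fun y : EuclideanSpace ℝ (Fin 3) =>
          ∫ σ in Ioo (0 : ℝ) 1, heatExtension (curl w) σ y) y = w y - heatExtension w 1 y := by
  obtain ⟨hωc, hω0, hω1⟩ := curl_bounds_of_bounded hw h1 h2
  have hA := fun y => hasFDerivAt_integral_heatExtension_time hωc hω0 hω1 y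
  refine ⟨fun y => (hA y).differentiableAt, fun y => norm_integral_heatExtension_time_le hω0 y,
    fun y => ?_⟩
  -- the curl through the time integral
  have hint : Integrable (fun σ : ℝ => heatExtension (fderiv ℝ (curl w)) σ y)
      (volume.restrict (Ioo (0 : ℝ) 1)) :=
    integrableOn_heatExtension_time (hωc.continuous_fderiv one_ne_zero) hω1 y
  have hcurlA : curl (fun y : EuclideanSpace ℝ (Fin 3) =>
      ∫ σ in Ioo (0 : ℝ) 1, heatExtension (curl w) σ y) y =
        ∫ σ in Ioo (0 : ℝ) 1, curl (heatExtension (curl w) σ) y := by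
    rw [curl_eq_curlCLM, (hA y).fderiv, ← curlCLM.integral_comp_comm hint]
    refine setIntegral_congr_fun measurableSet_Ioo fun σ hσ => ?_
    rw [curl_eq_curlCLM, fderiv_heatExtension_of_bounded hωc hω0 hω1 hσ.1 y]
  -- `curl e^{σΔ}(curl w) = e^{σΔ}(curl curl w) = −e^{σΔ}(Δw)`
  have hΔ : ∀ z, (Δ w) z = -curl (curl w) z := fun z => laplacian_eq_neg_curl_curl hw hdiv z
  have hstep : ∀ σ ∈ Ioo (0 : ℝ) 1, curl (heatExtension (curl w) σ) y =
      -heatExtension (Δ w) σ y := fun σ hσ => by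
    rw [curl_heatExtension_of_bounded hωc hω0 hω1 hσ.1 y]
    have heq : curl (curl w) = fun z => (-1 : ℝ) • (Δ w) z := funext fun z => by
      rw [hΔ z]; simp
    rw [heq, heatExtension_const_smul, neg_one_smul]
  -- the heat equation: `∂_σ e^{σΔ}w (y) = e^{σΔ}(Δw)(y)`, integrated on `(0, 1)`
  have hderiv : ∀ σ ∈ Ioo (0 : ℝ) 1, HasDerivAt (fun s => heatExtension w s y)
      (heatExtension (Δ w) σ y) σ := fun σ hσ =>
    hasDerivAt_heatExtension_time_of_bounded hw h0 h1 h2 hσ.1 y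
  have hwmem : MemLp w ⊤ (volume : Measure (EuclideanSpace ℝ (Fin 3))) :=
    memLp_top_of_continuous_of_bound hw.continuous h0
  -- bound for `Δw`
  have hΔc : Continuous (Δ w) := by
    have : ContDiff ℝ ((0 : ℕ∞) + 2 : ℕ∞) w := by simpa using hw
    exact (contDiff_laplacian (n := 0) this).continuous
  have hΔb : ∀ z, ‖(Δ w) z‖ ≤ ‖curlCLM‖ * (‖curlCLM‖ * C₂) := fun z => by
    rw [hΔ z, norm_neg, curl_eq_curlCLM]
    exact (curlCLM.le_opNorm _).trans (mul_le_mul_of_nonneg_left (hω1 z) (norm_nonneg _))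
  have hint' : IntervalIntegrable (fun σ : ℝ => heatExtension (Δ w) σ y) volume 0 1 := by
    rw [intervalIntegrable_iff_integrableOn_Ioo_of_le zero_le_one]
    exact integrableOn_heatExtension_time hΔc hΔb y
  have h0lim : Tendsto (fun s : ℝ => heatExtension w s y) (𝓝[>] 0) (𝓝 (w y)) :=
    tendsto_heatExtension_nhdsGT_zero_of_continuousAt hwmem le_top hw.continuous.continuousAt
  have h1lim : Tendsto (fun s : ℝ => heatExtension w s y) (𝓝[<] 1) (𝓝 (heatExtension w 1 y)) :=
    (hasDerivAt_heatExtension_time_of_bounded hw h0 h1 h2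
      zero_lt_one y).continuousAt.continuousWithinAt.tendsto
  have hFTC : ∫ σ in (0 : ℝ)..1, heatExtension (Δ w) σ y = heatExtension w 1 y - w y :=
    integral_eq_sub_of_hasDerivAt_of_tendsto zero_lt_one hderiv hint' h0lim h1lim
  -- assemble
  rw [hcurlA, setIntegral_congr_fun measurableSet_Ioo hstep, MeasureTheory.integral_neg,
    ← integral_Ioc_eq_integral_Ioo, ← intervalIntegral.integral_of_le zero_le_one, hFTC, neg_sub]

end Literature.Analysis.FluidPDE
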